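import Summits.BirchSwinnertonDyer.BirchSwinnertonDyer.Theses.SignedLowerHalves
import Summits.BirchSwinnertonDyer.BirchSwinnertonDyer.Theses.PrintX8VS
import Summits.BirchSwinnertonDyer.BirchSwinnertonDyer.Theorems.PrintX8VSSprungLowerDivisibilityAtThreeOfKatoSporadicParts
import HarnessLib

/-!
# Crux K1 `SprungLowerDivisibilityAtThree` (item stmt-BirchSwinnertonDyer-19875), line `chromatic-common-zeros`, skeleton v9:
# the route-`SignedLowerHalves` copy of K1 from the three `PrintX8VS` CHILDREN of the executed resplit, BY NAME

Cell `bsd-ssimc` (host), lead `cruxlead-stmt-BirchSwinnertonDyer-19875` (g4); `--supports stmt-BirchSwinnertonDyer-19875 --as helper`;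
theorems only; closes NO item. K1, its children, leaf X8 and BSD are NOT proved by anything here.

Item 19875 is ONE statement shared by two routes (`Theses.SignedLowerHalves.SprungLowerDivisibilityAtThree`, crux #3 of route
`SignedLowerHalves`; `Theses.PrintX8VS.SprungLowerDivisibilityAtThree`, crux #1 of route `PrintX8VS`; same text). The x8 resplit
W-81′ (route `PrintX8VS` rev 10, 2026-08-28T16:04Z) installed the children C1′ `PrintX8VS.KatoFineLowerSporadicX8` (item 22569, crux),
C2R `PrintX8VS.CyclotomicLowerRestX8R` (item 22570, crux), C4R `PrintX8VS.HeldInputsX8R` (item 22571, support, held) and the glue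
`PrintX8VS.SprungLowerDivisibilityAtThreeOfKatoSporadicParts` (item 22572, CLOSED by
`ChromaticCommonZeros.sprungLowerDivisibilityAtThreeOfKatoSporadicParts_holds`, p647908). Skeleton v9 of the parent line
(`Cruxes/SprungLowerDivisibilityAtThree/Lines/chromatic_common_zeros.lean`, lead g4) makes the three children its stubs BY NAME; this file
is its composition as a tree theorem for the OTHER route copy, so that when 22569, 22570, 22571 close, item 19875 closes on BOTH routes
by one application each:
* `sprungLowerDivisibilityAtThree_signedLowerHalves_iff_printX8VS` — the two route copies are the same statement;
* `sprungLowerDivisibilityAtThree_signedLowerHalves_of_x8Children` — `C1′ → C2R → C4R → SignedLowerHalves.SprungLowerDivisibilityAtThree`.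
CONDITIONAL (displayed hypotheses = the three child items, two of them OPEN cruxes: Kato 2004 Conj. 12.10 at the sporadic common zeros,
Sprung 2012 Main Conj. 7.21 at the remaining cyclotomic common zeros — both open in print at `(3, a₃ = ±3)`).

References: [Kato2004Asterisque] Conj. 12.10 (p. 224); [Sprung2012] Thm. 7.14 (p. 1504), Prop. 7.19 and Main Conj. 7.21 (p. 1505);
tree `…PrintX8VSSprungLowerDivisibilityAtThreeOfKatoSporadicParts` (p647908), `…KatoFineSporadicPrintX8VS` (p617761), `…KatoFineSporadic` (p614828).
-/

set_option linter.dupNamespace false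
set_option autoImplicit false

namespace Summit.BirchSwinnertonDyer.BirchSwinnertonDyer.Theorems.ChromaticCommonZeros

/-- **The two route copies of K1 are the same statement** (`Theses.SignedLowerHalves.SprungLowerDivisibilityAtThree` ↔
`Theses.PrintX8VS.SprungLowerDivisibilityAtThree`; both read `∀ W p, ClassX8 W p → ∀ •, SprungSharpFlatLowerDivisibility W p •`).
Pure bookkeeping. [cite: Sprung2012, Main Conj. 7.21 (p. 1505)] -/
theorem sprungLowerDivisibilityAtThree_signedLowerHalves_iff_printX8VS :
    Summit.BirchSwinnertonDyer.BirchSwinnertonDyer.Theses.SignedLowerHalves.SprungLowerDivisibilityAtThree ↔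
      Summit.BirchSwinnertonDyer.BirchSwinnertonDyer.Theses.PrintX8VS.SprungLowerDivisibilityAtThree :=
  ⟨fun h W _ _ p _ hX col => h W p hX col, fun h W _ _ p _ hX col => h W p hX col⟩

/-- **K1 on route `SignedLowerHalves` from the three `PrintX8VS` children BY NAME**: `KatoFineLowerSporadicX8 →
CyclotomicLowerRestX8R → HeldInputsX8R → SignedLowerHalves.SprungLowerDivisibilityAtThree` — the closed glue item 22572
(`sprungLowerDivisibilityAtThreeOfKatoSporadicParts_holds`: squeeze to the common-zero locus, `(3)` never common, `(T)` at
`r_an ≤ 1` by control + Gross–Zagier–Kolyvagin + signed simple zero, colour transfer, `eisenstein_iff_fine` at the sporadic primes)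
read on the other route copy. CONDITIONAL on the displayed child items (C1′ and C2R are OPEN cruxes, C4R is held); closes nothing.
[cite: Kato2004Asterisque, Conj. 12.10 (p. 224)] [cite: Sprung2012, Thm. 7.14 (p. 1504), Prop. 7.19 and Main Conj. 7.21 (p. 1505)] -/
theorem sprungLowerDivisibilityAtThree_signedLowerHalves_of_x8Children
    (hK : Summit.BirchSwinnertonDyer.BirchSwinnertonDyer.Theses.PrintX8VS.KatoFineLowerSporadicX8)
    (hC : Summit.BirchSwinnertonDyer.BirchSwinnertonDyer.Theses.PrintX8VS.CyclotomicLowerRestX8R)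
    (hH : Summit.BirchSwinnertonDyer.BirchSwinnertonDyer.Theses.PrintX8VS.HeldInputsX8R) :
    Summit.BirchSwinnertonDyer.BirchSwinnertonDyer.Theses.SignedLowerHalves.SprungLowerDivisibilityAtThree :=
  sprungLowerDivisibilityAtThree_signedLowerHalves_iff_printX8VS.mpr
    (sprungLowerDivisibilityAtThreeOfKatoSporadicParts_holds hK hC hH)

end Summit.BirchSwinnertonDyer.BirchSwinnertonDyer.Theorems.ChromaticCommonZeros
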